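import Summits.NavierStokesRegularity.FunctionalMining.StretchingLaminateUnconditional
import Summits.NavierStokesRegularity.FunctionalMining.NoGo.StretchingSupNotSharp
import HarnessLib

/-!
# FunctionalMining — K1-Q1: the kernel window of record `0.6752 ≤ C⋆ < 2/√3`, strict at the top (dict; F33.3)

search for candidate a priori estimates; no regularity claim.  Two one-line conjunctions of tree theorems;
nothing about Navier–Stokes solutions — `C⋆ = stretchingSupConst` is the optimal constant of ONE static
inequality `∫ ωᵀSω ≤ C·‖ω‖_∞·∫½|∇u|²` over smooth divergence-free fields on `T³`, and `C_lam = laminateSupConst`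
is the supremum of the leaf ratio over finite divergence-free lamination trees.

`StretchingLaminateUnconditional` (prove seat, p220890 / p221965) states the window with the Hölder end
`≤ 2/√3` (`Laminate.stretchingSupConst_window_e800`); the window OF RECORD is strict at the top —
`NoGo/StretchingSupNotSharp` (p205451: `not_stretchingSupSharp_fin3`, the equality case of
`|ωᵀSω| ≤ (2/√3)·|ω|·|S|` forces a non-periodic profile) read through `not_stretchingSupSharp_iff`
(`StretchingConst`).  This file records the strict conjunction once, so that a single declaration can be cited
(referee F33.3), together with the sandwich `0.6752 ≤ C_lam ≤ C⋆ < 2/√3`.  The VALUE of `C⋆` in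
`[0.6752, 2/√3)` and whether `C_lam = C⋆` (`LaminatesSharp`, V-GAP) remain open.
search for candidate a priori estimates; no regularity claim.
-/

namespace Summit.NavierStokesRegularity.FunctionalMining

namespace Laminate

/-- **Kernel window of record for K1-Q1: `422/625 = 0.6752 ≤ C⋆ < 2/√3`** — lower end the typed laminate
record (`e800_le_stretchingSupConst`, p221965), upper end STRICT (`not_stretchingSupSharp_fin3`, p205451).
[ours; bookkeeping] -/
theorem stretchingSupConst_window_e800_strict :
    (422 / 625 : ℝ) ≤ stretchingSupConst (d := Fin 3) ∧ stretchingSupConst (d := Fin 3) < 2 / Real.sqrt 3 :=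
  ⟨e800_le_stretchingSupConst, not_stretchingSupSharp_iff.mp not_stretchingSupSharp_fin3⟩

/-- The sandwich of record: `422/625 ≤ C_lam ≤ C⋆ < 2/√3` (Record3 p221501, `C_lam ≤ C⋆` p220890, p205451).
[ours; bookkeeping] -/
theorem e800_le_laminateSupConst_le_stretchingSupConst_lt :
    (422 / 625 : ℝ) ≤ laminateSupConst ∧ laminateSupConst ≤ stretchingSupConst (d := Fin 3) ∧
      stretchingSupConst (d := Fin 3) < 2 / Real.sqrt 3 :=
  ⟨e800_le_laminateSupConst, laminateSupConst_le_stretchingSupConst_holds,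
    not_stretchingSupSharp_iff.mp not_stretchingSupSharp_fin3⟩

end Laminate

end Summit.NavierStokesRegularity.FunctionalMining
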